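import Summits.QuantumAdvantage.QuantumAdvantage.Theorems.LinnikCubicClassGroupsDegreeOnePrimesEscapeClassPNTDHLinnikDegOne
import Literature.NumberTheory.LFunctions.DeuringHeilbronn
import HarnessLib

/-!
# Linnik's theorem for ideal classes in EVERY degree, unconditionally

Topic `Summits/QuantumAdvantage/QuantumAdvantage/Theorems`, cell B2b-1 (linnik-cubic), PART A (gen 4);
helper toward the crux `DegreeOnePrimesEscape` (stmt-QuantumAdvantage-11543) of route
`LinnikCubicClassGroups`.  HONEST FRAMING: the value of this file is a THEOREM (kernel-checked, GRH-free,
Siegel-free, no hypothesis) — NOT summit progress (the route still rests on the hypothesis-type target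
`PureCubicClassNumberHard`).

The Deuring–Heilbronn phenomenon for the `L`-functions of class group characters is a theorem of the tree
(`Literature.NumberTheory.LFunctions.NumberField.deuringHeilbronn`, PART A gen 3).  Feeding it to the
Linnik deduction of `…ClassPNTDHLinnik.lean` / `…ClassPNTDHLinnikDegOne.lean` discharges their only
hypothesis:

* `thetaClass_relative` — **the class prime number theorem with relative error in the Linnik range, every
  number field of degree `n > 1`** (Thorner–Zaman's Theorem 1.4 for the Hilbert class field, `θ`-form, with
  the exceptional term `χ₁(C) x^{β₁}/β₁` and error relative to the main term);
* `exists_prime_mem_class_absNorm_le` — **Linnik's theorem for ideal classes**: for every `n > 1` there is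
  `L = L(n)` such that every ideal class of every number field `K` of degree `n` contains a prime ideal of
  norm `≤ (|d_K|·nⁿ)^{L}` [Weiss1983, Thm. 5.2 for `H_K/K`] — previously in the tree only for odd `n`
  (`exists_prime_mem_class_absNorm_le_of_odd`) or under `NoSiegelZeros`
  (`exists_prime_mem_class_absNorm_le_of_noSiegelZeros`);
* `exists_degOnePrime_mem_class_absNorm_le` — the same with a prime ideal of RESIDUE DEGREE ONE.

References: A. Weiss, *The least prime ideal*, J. reine angew. Math. 338 (1983), Thm. 5.2 [Weiss1983];
J. Thorner, A. Zaman, Algebra Number Theory 13 (2019), Thm. 1.4 [ThornerZaman2019];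
J. C. Lagarias, H. L. Montgomery, A. M. Odlyzko, Invent. Math. 54 (1979) [LagariasMontgomeryOdlyzko1979].
-/

noncomputable section

open Complex Real MeasureTheory Set Filter Topology
open scoped NumberField nonZeroDivisors

namespace Summit.QuantumAdvantage.QuantumAdvantage.Theorems.DegreeOnePrimesEscape

open Literature.NumberTheory.LFunctions Literature.NumberTheory.LFunctions.NumberField
  Literature.NumberTheory.LFunctions.AbelianDensity

/-- **The class prime number theorem with RELATIVE error in the Linnik range, every number field of degree
`n > 1`, unconditionally**: for `ε > 0` there are `a₂ ≥ 1` and `0 < c ≤ 1/(8(n²+1))` such that for every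
number field `K` of degree `n`, EITHER `|θ_C(x) − x/h_K| ≤ ε x/h_K` for all `x ≥ Q^{a₂}` and all classes
`C`, OR there is a real class group character `χ₁` with a real zero `β₁ ∈ (1 − c/(log|d_K| + log 4), 1)` of
`L(s, χ₁)` such that, with `M_C(x) = x − χ₁(C) x^{β₁}/β₁ > 0`, `|θ_C(x) − M_C(x)/h_K| ≤ ε M_C(x)/h_K` for
all `x ≥ Q^{a₂}` and all `C` (`Q = |d_K|·nⁿ`). [cite: ThornerZaman2019, Theorem 1.4]
[cite: Weiss1983, Theorem 5.2] -/
theorem thetaClass_relative (n : ℕ) (hn : 1 < n) {ε : ℝ} (hε : 0 < ε) :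
    ∃ a₂ c : ℝ, 1 ≤ a₂ ∧ 0 < c ∧ c ≤ 1 / (8 * ((n : ℝ) ^ 2 + 1)) ∧
    ∀ (K : Type) [Field K] [NumberField K], Module.finrank ℚ K = n →
      (∀ x : ℝ, ThornerZaman.condQn K ^ a₂ ≤ x → ∀ C : ClassGroup (𝓞 K),
          |chebyshevThetaIdealClass K C x - x / NumberField.classNumber K| ≤
            ε * x / NumberField.classNumber K) ∨
      ∃ (χ₁ : ClassGroup (𝓞 K) →* ℂˣ) (β₁ : ℝ), χ₁ * χ₁ = 1 ∧
          1 - c / (Real.log ((NumberField.discr K).natAbs : ℝ) + Real.log 4) < β₁ ∧ β₁ < 1 ∧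
          classGroupLFunction K χ₁ β₁ = 0 ∧
          ∀ x : ℝ, ThornerZaman.condQn K ^ a₂ ≤ x → ∀ C : ClassGroup (𝓞 K),
            0 < x - ((χ₁ C : ℂ)).re * x ^ β₁ / β₁ ∧
            |chebyshevThetaIdealClass K C x -
                (x - ((χ₁ C : ℂ)).re * x ^ β₁ / β₁) / NumberField.classNumber K| ≤
              ε * (x - ((χ₁ C : ℂ)).re * x ^ β₁ / β₁) / NumberField.classNumber K :=
  thetaClass_relative_of_zeroRepulsion deuringHeilbronn n hn hε

/-- **Linnik's theorem for ideal classes, every degree, unconditionally**: for `n > 1` there is `L > 0`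
such that every ideal class of every number field `K` of degree `n` contains a prime ideal of norm
`≤ Q^{L}`, `Q = |d_K|·nⁿ`.  GRH-free, Siegel-free, no hypothesis. [cite: Weiss1983, Theorem 5.2] -/
theorem exists_prime_mem_class_absNorm_le (n : ℕ) (hn : 1 < n) :
    ∃ L : ℝ, 0 < L ∧ ∀ (K : Type) [Field K] [NumberField K], Module.finrank ℚ K = n →
      ∀ C : ClassGroup (𝓞 K), ∃ (P : Ideal (𝓞 K)) (hP : P ∈ (Ideal (𝓞 K))⁰), P.IsPrime ∧
        ClassGroup.mk0 ⟨P, hP⟩ = C ∧ (Ideal.absNorm P : ℝ) ≤ ThornerZaman.condQn K ^ L :=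
  exists_prime_mem_class_absNorm_le_of_zeroRepulsion deuringHeilbronn n hn

/-- **Linnik's theorem for DEGREE-ONE prime ideals in ideal classes, every degree, unconditionally**: for
`n > 1` there is `L > 0` such that every ideal class of every number field `K` of degree `n` contains a
prime ideal whose norm is a rational prime `≤ Q^{L}`, `Q = |d_K|·nⁿ`. [cite: Weiss1983, Theorem 5.2] -/
theorem exists_degOnePrime_mem_class_absNorm_le (n : ℕ) (hn : 1 < n) :
    ∃ L : ℝ, 0 < L ∧ ∀ (K : Type) [Field K] [NumberField K], Module.finrank ℚ K = n →
      ∀ C : ClassGroup (𝓞 K), ∃ (P : Ideal (𝓞 K)) (hP : P ∈ (Ideal (𝓞 K))⁰), (Ideal.absNorm P).Prime ∧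
        ClassGroup.mk0 ⟨P, hP⟩ = C ∧ (Ideal.absNorm P : ℝ) ≤ ThornerZaman.condQn K ^ L :=
  exists_degOnePrime_mem_class_absNorm_le_of_zeroRepulsion deuringHeilbronn n hn

/-- `Q = |d_K|·nⁿ ≤ |d_K|^{1 + n log n/log 3}` for a number field of degree `n > 1` (`|d_K| ≥ 3`). [folklore] -/
theorem condQn_le_natAbs_discr_rpow (K : Type) [Field K] [NumberField K] (hK : 1 < Module.finrank ℚ K) :
    ThornerZaman.condQn K ≤ ((NumberField.discr K).natAbs : ℝ) ^
      (1 + Module.finrank ℚ K * Real.log (Module.finrank ℚ K) / Real.log 3) := by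
  set n : ℕ := Module.finrank ℚ K with hn
  set d : ℝ := ((NumberField.discr K).natAbs : ℝ) with hd
  have hd3 : (3 : ℝ) ≤ d := by
    have h2 := NumberField.abs_discr_gt_two hK
    rw [hd, Nat.cast_natAbs]
    exact_mod_cast (show (3 : ℤ) ≤ |NumberField.discr K| by omega)
  have hd0 : 0 < d := by linarith
  have hlog3 : 0 < Real.log 3 := Real.log_pos (by norm_num)
  have hlogd : Real.log 3 ≤ Real.log d := Real.log_le_log (by norm_num) hd3
  have hn0 : (0 : ℝ) < n := by rw [hn]; exact_mod_cast (lt_trans Nat.zero_lt_one hK)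
  have hQ : ThornerZaman.condQn K = d * (n : ℝ) ^ n := by
    rw [ThornerZaman.condQn, hd, Nat.cast_natAbs, Int.cast_abs]
  -- `nⁿ = exp(n log n) ≤ exp((n log n / log 3) log d) = d^{n log n / log 3}`
  have hnn : ((n : ℝ) ^ n : ℝ) ≤ d ^ ((n : ℝ) * Real.log n / Real.log 3) := by
    rw [← Real.rpow_natCast, Real.rpow_def_of_pos hn0, Real.rpow_def_of_pos hd0, Real.exp_le_exp]
    have hlogn : 0 ≤ Real.log n := Real.log_nonneg (by exact_mod_cast hK.le)
    have h1 : (n : ℝ) * Real.log n / Real.log 3 * Real.log 3 ≤ (n : ℝ) * Real.log n / Real.log 3 * Real.log d :=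
      mul_le_mul_of_nonneg_left hlogd (by positivity)
    have e : (n : ℝ) * Real.log n / Real.log 3 * Real.log 3 = Real.log n * n := by field_simp
    linarith
  rw [hQ, Real.rpow_add hd0, Real.rpow_one]
  exact mul_le_mul_of_nonneg_left hnn hd0.le

/-- **Linnik's theorem for ideal classes in terms of the discriminant**: for `n > 1` there is `L > 0` such
that every ideal class of every number field `K` of degree `n` contains a prime ideal of norm `≤ |d_K|^{L}`
(the shape of [Weiss1983, Theorem 5.2] / the Hilbert-class-field case of Thorner–Zaman's explicit bound).
Unconditional. [cite: Weiss1983, Theorem 5.2] -/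
theorem exists_prime_mem_class_absNorm_le_discr (n : ℕ) (hn : 1 < n) :
    ∃ L : ℝ, 0 < L ∧ ∀ (K : Type) [Field K] [NumberField K], Module.finrank ℚ K = n →
      ∀ C : ClassGroup (𝓞 K), ∃ (P : Ideal (𝓞 K)) (hP : P ∈ (Ideal (𝓞 K))⁰), P.IsPrime ∧
        ClassGroup.mk0 ⟨P, hP⟩ = C ∧
          (Ideal.absNorm P : ℝ) ≤ ((NumberField.discr K).natAbs : ℝ) ^ L := by
  obtain ⟨L, hL, h⟩ := exists_prime_mem_class_absNorm_le n hn
  have hn0 : (0 : ℝ) < n := by exact_mod_cast (lt_trans Nat.zero_lt_one hn)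
  have hlog3 : 0 < Real.log 3 := Real.log_pos (by norm_num)
  have hlogn : 0 ≤ Real.log n := Real.log_nonneg (by exact_mod_cast hn.le)
  refine ⟨(1 + n * Real.log n / Real.log 3) * L, by positivity, fun K _ _ hKn C ↦ ?_⟩
  have hK : 1 < Module.finrank ℚ K := by rw [hKn]; exact hn
  obtain ⟨P, hP, hprime, hC, hle⟩ := h K hKn C
  refine ⟨P, hP, hprime, hC, hle.trans ?_⟩
  have hd1 : (1 : ℝ) ≤ ((NumberField.discr K).natAbs : ℝ) := by
    have h1 := Int.one_le_abs (NumberField.discr_ne_zero K)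
    rw [Int.abs_eq_natAbs] at h1
    exact_mod_cast h1
  have hQ := condQn_le_natAbs_discr_rpow K hK
  rw [hKn] at hQ
  calc ThornerZaman.condQn K ^ L ≤ (((NumberField.discr K).natAbs : ℝ) ^
        (1 + (n : ℝ) * Real.log n / Real.log 3)) ^ L :=
        Real.rpow_le_rpow (le_trans (by norm_num) (ThornerZaman.twelve_le_condQn (K := K) hK)) hQ hL.le
    _ = ((NumberField.discr K).natAbs : ℝ) ^ ((1 + n * Real.log n / Real.log 3) * L) := by
        rw [← Real.rpow_mul (by linarith)]

end Summit.QuantumAdvantage.QuantumAdvantage.Theorems.DegreeOnePrimesEscape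

end
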